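import Literature.AnabelianGeometry.EtaleTheta.Discharge.Sec2ModelKummerLifting
import Literature.AnabelianGeometry.EtaleTheta.Discharge.Sec2DtpYThetaAbelianCorollaries

/-!
# [EtTh] §2, Cor. 2.18 (iv) read against the level `1` of a tower: lifting automorphisms of the
# mod-`1` model to the mod-`M` model, and finiteness of the automorphisms over the identity of level `1`

Mochizuki, *The Étale Theta Function …* [EtTh], Publ. RIMS 45 (2009), §2, Cor. 2.18 (iv) pp.61–63
("a natural homomorphism `Aut^μ(M) → Aut^μ(M_M)` … hence a bijection if `N/M` is odd [in general its
kernel and cokernel are those of `Hom(ℤ/2ℤ, μ_{M'}) → Hom(ℤ/2ℤ, μ_M)`]") and Cor. 2.19 (ii) proof p.66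
("the `R¹lim`'s of the projective system `{Hom(ℤ/2ℤ, ℤ/Nℤ)}_N` … as well as … `{μ_N}_N`, vanish")
[cite: MochizukiEtTh2009, Cor 2.18(iv) p.61]. PROOF-ONLY companion (theorems only; no `def : Prop`, no
new named fact) of `ThetaSystems.lean` / `ThetaRigidity.lean` (seats abc-iut-L2-t2, L2-d1), written by
abc-iut-w4-d024 for the abc-iut GAP-LEDGER row G-w4d030-1 ([IUTchII] Prop. 1.5 (i) over the GENUINE
model family; consumer: the L6 closing theorem `MonoThetaProjSystem.prop15_i'_of_cor218_iv`, whose two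
hypotheses `hlift`/`hfin` are Cor. 2.18 (iv) READ AGAINST THE LEVEL `M = 1`).

For a tower `T : ThetaEnvTower E` (`1 ∈ E`) and a level `M ∈ E` with mod-`M` theta cocycle `η`:
* `exists_iso_lift_of_levelOne` — every automorphism `φ` of the mod-`1` model `M(red ∘ η)` LIFTS along
  the reduction `Π^tp_Y[μ_M] ↠ Π^tp_Y[μ_1]` to an automorphism of the mod-`M` model `M(η)`: from
  Cor. 2.18 (iii) (`φ` lies over an automorphism `γ` of `Π^tp_X`: `Sec2IsoLift`), the SURJECTIVITY clause
  of Cor. 2.18 (iv) at level `M` (`γ` lifts to `M(η)`), the REDUCTION clause (`Cor218_iv_reduction`) and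
  the triviality of `μ_1` (an automorphism of `Π^tp_Y[μ_1]` is determined by the automorphism of
  `Π^tp_X` it lies over) — i.e. "coker = coker(Hom(ℤ/2, μ_M) → Hom(ℤ/2, μ_1)) = 0";
* `finite_iso_over_levelOne` — the automorphisms of `M(η)` reducing to the IDENTITY of the mod-`1`
  model form a finite set: they induce the identity on `Π^tp_Y`, so this is abc-iut-L2-d1's
  `ThetaEnvData.finite_autOverId` (FIBRE clause of Cor. 2.18 (iv): `μ_M`-conjugates of twists by the
  finite group `Hom(Π^tp_Y/Π^tp_Ÿ, μ_M)`).
All named [EtTh] inputs enter as explicit hypotheses in the unfolded `ThetaEnvData`-level shapes used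
by `ThetaEnvTower.cor219_ii_of` (they are theorems for the [EtTh] §1 model tower, `Sec2ModelKummerLifting`).
HONEST FRAMING: conditional packaging; nothing disputed is asserted; no side is taken on [IUTchIII]
Cor. 3.12; typed ≠ discharged.
-/

namespace Literature.AnabelianGeometry.EtaleTheta

universe u

namespace ThetaEnvTower

variable {E : Set ℕ+} (T : ThetaEnvTower.{u} E)

/-! ## The level `1 ∈ E` -/

/-- `μ_1` is trivial (it has `1` element). [cite: MochizukiEtTh2009, Def 2.10 p.44] -/
theorem subsingleton_mu_levelOne : Subsingleton (T.mu (⟨1, T.one_mem⟩ : E)) := by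
  rw [← Fintype.card_le_one_iff_subsingleton, T.card_mu]
  exact le_of_eq PNat.one_coe

/-- At level `1` an element of `Π^tp_Y[μ_1] = μ_1 ⋊ Π^tp_Y` is determined by its `Π^tp_Y`-coordinate.
[cite: MochizukiEtTh2009, Def 2.13(ii) p.48] -/
theorem env_levelOne_ext {x y : (T.level (⟨1, T.one_mem⟩ : E)).env} (h : x.right = y.right) : x = y := by
  haveI := T.subsingleton_mu_levelOne
  ext
  · exact Subsingleton.elim _ _
  · rw [h]

/-- **An automorphism of the mod-`1` envelope is determined by the automorphism of `Π^tp_X` it lies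
over** (`μ_1` trivial): two isomorphisms over the same `γ` have the same underlying map.
[cite: MochizukiEtTh2009, Cor 2.18(iv) p.61] -/
theorem mulEquiv_levelOne_eq_of_over (e₁ e₂ : (T.level (⟨1, T.one_mem⟩ : E)).env ≃* (T.level (⟨1, T.one_mem⟩ : E)).env)
    (γ : T.PiX ≃ₜ* T.PiX) (h₁ : ∀ x, ((e₁ x).right : T.PiX) = γ (x.right : T.PiX))
    (h₂ : ∀ x, ((e₂ x).right : T.PiX) = γ (x.right : T.PiX)) (x : (T.level (⟨1, T.one_mem⟩ : E)).env) :
    e₁ x = e₂ x :=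
  T.env_levelOne_ext (Subtype.ext ((h₁ x).trans (h₂ x).symm))

/-! ## Lifting automorphisms of the mod-`1` model to the mod-`M` model -/

/-- **Cor. 2.18 (iv) against level `1`, LIFTING**: for a level `M ∈ E` with theta cocycle `η`, every
automorphism `φ` of the mod-`1` model mono-theta environment `M(red_{1,M} ∘ η)` lifts along the
reduction `Π^tp_Y[μ_M] ↠ Π^tp_Y[μ_1]` to an automorphism `ψ` of the mod-`M` model `M(η)`:
`red ∘ ψ = φ ∘ red`. Inputs (hypotheses, [EtTh]-named): temp-slimness of `Π^tp_X` in the form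
"conjugation on `Π^tp_Y` is faithful" + the group-theoreticity of `Π• ↠ Π•_Y` at level `1`
(Cor. 2.18 (iii)), the surjectivity clause of Cor. 2.18 (iv) at level `M`, and the reduction clause
`Cor218_iv_reduction`. [cite: MochizukiEtTh2009, Cor 2.18(iv) p.61] -/
theorem exists_iso_lift_of_levelOne
    (hslim : ∀ x : T.PiX, (∀ h : T.PiY, x * h * x⁻¹ = h) → x = 1)
    (hq : centralizerUnion (T.level (⟨1, T.one_mem⟩ : E)).env =
      (CycEnvelope.proj (T.level (⟨1, T.one_mem⟩ : E)).augY (T.level (⟨1, T.one_mem⟩ : E)).chi).ker)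
    (hred : T.Cor218_iv_reduction) (M : E) {η : T.PiYdd → T.mu M} (hη : η ∈ T.thetaCocycles M)
    (hlift : ∀ γ : T.PiX ≃ₜ* T.PiX, T.PiY.map γ.toMulEquiv.toMonoidHom = T.PiY →
      ∃ α : ((T.level M).modelMono hη).Iso ((T.level M).modelMono hη),
        ∀ x, ((CycEnvelope.proj (T.level M).augY (T.level M).chi (α.e x) : T.PiY) : T.PiX) =
          γ (CycEnvelope.proj (T.level M).augY (T.level M).chi x : T.PiY))
    (φ : ((T.level (⟨1, T.one_mem⟩ : E)).modelMono (T.red_cocycle_mem (⟨1, T.one_mem⟩ : E) M (one_dvd _) η hη)).Iso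
      ((T.level (⟨1, T.one_mem⟩ : E)).modelMono (T.red_cocycle_mem (⟨1, T.one_mem⟩ : E) M (one_dvd _) η hη))) :
    ∃ ψ : ((T.level M).modelMono hη).Iso ((T.level M).modelMono hη),
      ∀ x, T.redEnv (⟨1, T.one_mem⟩ : E) M (one_dvd _) (ψ.e x) =
        φ.e (T.redEnv (⟨1, T.one_mem⟩ : E) M (one_dvd _) x) := by
  -- (1) `φ` lies over an automorphism `γ` of `Π^tp_X` (Cor. 2.18 (iii))
  obtain ⟨γ, hγ⟩ : ∃ γ : T.PiX ≃ₜ* T.PiX, ∀ x, ((φ.e x).right : T.PiX) = γ (x.right : T.PiX) := by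
    refine ThetaEnvData.exists_continuousMulEquiv_PiX_of_iso φ ?_ hslim
    rw [← hq]
    exact map_centralizerUnion_eq φ.e
  -- (2) `γ` preserves `Π^tp_Y`, hence lifts to the mod-`M` model (Cor. 2.18 (iv), surjectivity)
  have hPiY : T.PiY.map γ.toMulEquiv.toMonoidHom = T.PiY :=
    T.map_PiY_eq_of_over φ.e.toMulEquiv γ fun x => hγ x
  obtain ⟨α, hα⟩ := hlift γ hPiY
  -- (3) the reduction of `α` to level `1` lies over `γ`, as does `φ`; so they agree (`μ_1` trivial)
  obtain ⟨β, hβ⟩ := hred (⟨1, T.one_mem⟩ : E) M (one_dvd _) η hη α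
  have hβγ : ∀ y, ((β.e y).right : T.PiX) = γ (y.right : T.PiX) := by
    intro y
    obtain ⟨x, rfl⟩ := T.redEnv_surjective (⟨1, T.one_mem⟩ : E) M (one_dvd _) y
    have e1 : β.e (T.redEnv (⟨1, T.one_mem⟩ : E) M (one_dvd _) x) =
        T.redEnv (⟨1, T.one_mem⟩ : E) M (one_dvd _) (α.e x) := (hβ x).symm
    rw [e1, T.right_redEnv, T.right_redEnv]
    exact hα x
  refine ⟨α, fun x => ?_⟩
  have e2 : T.redEnv (⟨1, T.one_mem⟩ : E) M (one_dvd _) (α.e x) =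
      β.e (T.redEnv (⟨1, T.one_mem⟩ : E) M (one_dvd _) x) := hβ x
  rw [e2]
  exact T.mulEquiv_levelOne_eq_of_over β.e.toMulEquiv φ.e.toMulEquiv γ hβγ hγ _

/-- `exists_iso_lift_of_levelOne` with the mod-`1` model presented by ANY cocycle `η₁` equal to
`red_{1,M} ∘ η` (e.g. the reduction of a fixed root cocycle computed through another identification):
the statement transported along the equality of cocycles. [cite: MochizukiEtTh2009, Cor 2.18(iv) p.61] -/
theorem exists_iso_lift_of_levelOne'
    (hslim : ∀ x : T.PiX, (∀ h : T.PiY, x * h * x⁻¹ = h) → x = 1)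
    (hq : centralizerUnion (T.level (⟨1, T.one_mem⟩ : E)).env =
      (CycEnvelope.proj (T.level (⟨1, T.one_mem⟩ : E)).augY (T.level (⟨1, T.one_mem⟩ : E)).chi).ker)
    (hred : T.Cor218_iv_reduction) (M : E) {η : T.PiYdd → T.mu M} (hη : η ∈ T.thetaCocycles M)
    (hlift : ∀ γ : T.PiX ≃ₜ* T.PiX, T.PiY.map γ.toMulEquiv.toMonoidHom = T.PiY →
      ∃ α : ((T.level M).modelMono hη).Iso ((T.level M).modelMono hη),
        ∀ x, ((CycEnvelope.proj (T.level M).augY (T.level M).chi (α.e x) : T.PiY) : T.PiX) =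
          γ (CycEnvelope.proj (T.level M).augY (T.level M).chi x : T.PiY))
    {η₁ : T.PiYdd → T.mu (⟨1, T.one_mem⟩ : E)} (hη₁ : η₁ ∈ T.thetaCocycles (⟨1, T.one_mem⟩ : E))
    (hcompat : T.red (⟨1, T.one_mem⟩ : E) M (one_dvd _) ∘ η = η₁)
    (φ : ((T.level (⟨1, T.one_mem⟩ : E)).modelMono hη₁).Iso ((T.level (⟨1, T.one_mem⟩ : E)).modelMono hη₁)) :
    ∃ ψ : ((T.level M).modelMono hη).Iso ((T.level M).modelMono hη),
      ∀ x, T.redEnv (⟨1, T.one_mem⟩ : E) M (one_dvd _) (ψ.e x) =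
        φ.e (T.redEnv (⟨1, T.one_mem⟩ : E) M (one_dvd _) x) := by
  subst hcompat
  exact T.exists_iso_lift_of_levelOne hslim hq hred M hη hlift φ

/-- `exists_iso_lift_of_levelOne` with the Cor. 2.18 (iii) inputs absorbed by TEMP-SLIMNESS of `Π^tp_X`
("every open subgroup has trivial centraliser", [SemiAnbd] Ex. 3.10; `cor218_iii_of_tempSlim`).
[cite: MochizukiEtTh2009, Cor 2.18(iv) p.61] -/
theorem exists_iso_lift_of_levelOne_of_tempSlim
    (hts : ∀ U : Subgroup T.PiX, IsOpen (U : Set T.PiX) →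
      ∀ z : T.PiX, (∀ u ∈ U, z * u = u * z) → z = 1)
    (hred : T.Cor218_iv_reduction) (M : E) {η : T.PiYdd → T.mu M} (hη : η ∈ T.thetaCocycles M)
    (hlift : ∀ γ : T.PiX ≃ₜ* T.PiX, T.PiY.map γ.toMulEquiv.toMonoidHom = T.PiY →
      ∃ α : ((T.level M).modelMono hη).Iso ((T.level M).modelMono hη),
        ∀ x, ((CycEnvelope.proj (T.level M).augY (T.level M).chi (α.e x) : T.PiY) : T.PiX) =
          γ (CycEnvelope.proj (T.level M).augY (T.level M).chi x : T.PiY))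
    {η₁ : T.PiYdd → T.mu (⟨1, T.one_mem⟩ : E)} (hη₁ : η₁ ∈ T.thetaCocycles (⟨1, T.one_mem⟩ : E))
    (hcompat : T.red (⟨1, T.one_mem⟩ : E) M (one_dvd _) ∘ η = η₁)
    (φ : ((T.level (⟨1, T.one_mem⟩ : E)).modelMono hη₁).Iso ((T.level (⟨1, T.one_mem⟩ : E)).modelMono hη₁)) :
    ∃ ψ : ((T.level M).modelMono hη).Iso ((T.level M).modelMono hη),
      ∀ x, T.redEnv (⟨1, T.one_mem⟩ : E) M (one_dvd _) (ψ.e x) =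
        φ.e (T.redEnv (⟨1, T.one_mem⟩ : E) M (one_dvd _) x) :=
  T.exists_iso_lift_of_levelOne' (T.cor218_iii_of_tempSlim hts).1 ((T.cor218_iii_of_tempSlim hts).2 _)
    hred M hη hlift hη₁ hcompat φ

/-! ## Finiteness of the automorphisms over the identity of the mod-`1` model -/

/-- Two isomorphisms of model mono-theta environments with the same underlying map are equal (the other
fields are propositions). [cite: MochizukiEtTh2009, Def 2.13(ii) p.48] -/
theorem modelMono_iso_eq_of_e_eq {M : E} {η : T.PiYdd → T.mu M} {hη : η ∈ T.thetaCocycles M}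
    {ψ₁ ψ₂ : ((T.level M).modelMono hη).Iso ((T.level M).modelMono hη)} (h : ψ₁.e = ψ₂.e) :
    ψ₁ = ψ₂ := by
  obtain ⟨e₁, _, _⟩ := ψ₁
  obtain ⟨e₂, _, _⟩ := ψ₂
  cases h
  rfl

/-- **Cor. 2.18 (iv) against level `1`, FINITE FIBRE**: for a level `M ∈ E` with theta cocycle `η`,
only finitely many automorphisms of the mod-`M` model `M(η)` reduce to the IDENTITY of the mod-`1` model
(they induce the identity on `Π^tp_Y`, so they lie in the fibre of Cor. 2.18 (iv): `μ_M`-conjugates of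
twists by `Hom(Π^tp_Y/Π^tp_Ÿ, μ_M)` — abc-iut-L2-d1's `finite_autOverId`). Input: the fibre clause of
Cor. 2.18 (iv) at level `M` (first half). [cite: MochizukiEtTh2009, Cor 2.18(iv) p.63] -/
theorem finite_iso_over_levelOne (M : E) {η : T.PiYdd → T.mu M} (hη : η ∈ T.thetaCocycles M)
    (hfib : ∀ α : ((T.level M).modelMono hη).Iso ((T.level M).modelMono hη),
      (∀ x, CycEnvelope.proj (T.level M).augY (T.level M).chi (α.e x) =
        CycEnvelope.proj (T.level M).augY (T.level M).chi x) →
      ∃ (φ : T.PiY →* T.mu M) (_ : ∀ g : T.PiYdd, φ ((T.level M).inclYdd g) = 1) (c : T.mu M),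
        ∀ x : (T.level M).env, α.e x =
          MulAut.conj (CycEnvelope.inMu (T.level M).augY (T.level M).chi c)
            (CycEnvelope.inMu (T.level M).augY (T.level M).chi
              (φ (CycEnvelope.proj (T.level M).augY (T.level M).chi x)) * x)) :
    Set.Finite {ψ : ((T.level M).modelMono hη).Iso ((T.level M).modelMono hη) |
      ∀ x, T.redEnv (⟨1, T.one_mem⟩ : E) M (one_dvd _) (ψ.e x) =
        T.redEnv (⟨1, T.one_mem⟩ : E) M (one_dvd _) x} := by
  have hK := ThetaEnvData.finite_autOverId (T := T.level M) (hη := hη) hfib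
  refine Set.Finite.of_finite_image (f := fun ψ => (ψ.e.toMulEquiv : MulAut (T.level M).env))
    (hK.subset ?_) ?_
  · rintro _ ⟨ψ, hψ, rfl⟩
    refine ⟨⟨ψ, fun x => rfl⟩, fun x => ?_⟩
    have e := congrArg SemidirectProduct.right (hψ x)
    rw [T.right_redEnv, T.right_redEnv] at e
    exact e
  · intro ψ₁ _ ψ₂ _ h
    exact T.modelMono_iso_eq_of_e_eq (ContinuousMulEquiv.ext fun x => MulEquiv.congr_fun h x)

end ThetaEnvTower

/-! ## At the [EtTh] §1 model tower of `X̲̲` (abc-iut-L2-t8's `thetaEnvTower`, any chain) -/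

namespace ThetaSetting.EtaleThetaData.DoubleUnderline

open Literature.AnabelianGeometry.SemiGraphs
open Literature.AlgebraicGeometry.Frobenioids (IsSlimGroup)

variable {p : ℕ} [Fact p.Prime] {D : ThetaSetting p} {E : D.EtaleThetaData} {l : ℕ}
  (C : E.DoubleUnderline l) {Es : Set ℕ+} (τ : D.CyclotomeTower l Es)

/-- **Lifting from level `1`, FOR THE §1 MODEL TOWER** (over any cofinal chain `Es ∋ 1`): every
automorphism of the mod-`1` model lifts along `Π^tp_Y̲̲[μ_M] ↠ Π^tp_Y̲̲[μ_1]` to the mod-`M` model, modulo: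
temp-slimness of `Π^tp_X` ([SemiAnbd] Ex. 3.10, `hslimX`), openness of `Π^tp_X → G_K` (`haugOpen`, as in
`cor218_iv_reduction_model`), abc-iut-L2-t1's named fact `Prop15iii` (input of `rigidData`) and the
Cor. 2.18 (iv) surjectivity fact at level `M` on t8's rigidity data (`RigidData.Cor218_iv_surjective`,
itself ⟸ Cor. 2.18 (i)(ii) + constant multiple rigidity by abc-iut-L2-t10). [cite: MochizukiEtTh2009, Cor 2.18(iv) p.61] -/
theorem exists_iso_lift_of_levelOne_model (hC : D.Compat) (hS : D.Sec2Hyps) (hslimX : IsSlimGroup D.PiTemp)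
    (haugOpen : IsOpenMap D.aug) (h15 : Prop15iii E hC) (L : C.CuspLabels) (M : Es)
    (hlift : (C.rigidData (τ.mod M) hC hS h15 L).Cor218_iv_surjective)
    {η : (C.thetaEnvTower τ hC hS).PiYdd → MuN p M}
    (hη : η ∈ (C.thetaEnvTower τ hC hS).thetaCocycles M)
    {η₁ : (C.thetaEnvTower τ hC hS).PiYdd → MuN p (⟨1, τ.one_mem⟩ : Es)}
    (hη₁ : η₁ ∈ (C.thetaEnvTower τ hC hS).thetaCocycles (⟨1, τ.one_mem⟩ : Es))
    (hcompat : (C.thetaEnvTower τ hC hS).red (⟨1, τ.one_mem⟩ : Es) M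
      (one_dvd _) ∘ η = η₁)
    (φ : (((C.thetaEnvTower τ hC hS).level (⟨1, τ.one_mem⟩ : Es)).modelMono hη₁).Iso
      (((C.thetaEnvTower τ hC hS).level (⟨1, τ.one_mem⟩ : Es)).modelMono hη₁)) :
    ∃ ψ : (((C.thetaEnvTower τ hC hS).level M).modelMono hη).Iso
        (((C.thetaEnvTower τ hC hS).level M).modelMono hη),
      ∀ x, (C.thetaEnvTower τ hC hS).redEnv (⟨1, τ.one_mem⟩ : Es) M
          (one_dvd _) (ψ.e x) =
        φ.e ((C.thetaEnvTower τ hC hS).redEnv (⟨1, τ.one_mem⟩ : Es) M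
          (one_dvd _) x) :=
  (C.thetaEnvTower τ hC hS).exists_iso_lift_of_levelOne_of_tempSlim (C.tempSlim_Huu hslimX)
    (C.cor218_iv_reduction_model τ hC hS hslimX haugOpen) M hη
    (fun γ hγ => (RigidData.cor218_iv_surjective_iff _).1 hlift η hη γ hγ) hη₁ hcompat φ

/-- **Finite fibre over level `1`, FOR THE §1 MODEL TOWER**: only finitely many automorphisms of the
mod-`M` model reduce to the identity of the mod-`1` model, modulo `Prop15iii` and Prop. 2.14 (i) on t8's
rigidity data at level `M` (`RigidData.Prop214_i`; abc-iut-L2-t10's `cor218_iv_fibre_of_prop214_i`).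
[cite: MochizukiEtTh2009, Cor 2.18(iv) p.63] -/
theorem finite_iso_over_levelOne_model (hC : D.Compat) (hS : D.Sec2Hyps) (h15 : Prop15iii E hC)
    (L : C.CuspLabels) (M : Es) (h214i : (C.rigidData (τ.mod M) hC hS h15 L).Prop214_i)
    {η : (C.thetaEnvTower τ hC hS).PiYdd → MuN p M}
    (hη : η ∈ (C.thetaEnvTower τ hC hS).thetaCocycles M) :
    Set.Finite {ψ : (((C.thetaEnvTower τ hC hS).level M).modelMono hη).Iso
        (((C.thetaEnvTower τ hC hS).level M).modelMono hη) |
      ∀ x, (C.thetaEnvTower τ hC hS).redEnv (⟨1, τ.one_mem⟩ : Es) M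
          (one_dvd _) (ψ.e x) =
        (C.thetaEnvTower τ hC hS).redEnv (⟨1, τ.one_mem⟩ : Es) M
          (one_dvd _) x} :=
  (C.thetaEnvTower τ hC hS).finite_iso_over_levelOne M hη fun α hα =>
    ((RigidData.cor218_iv_fibre_iff _).1
      ((C.rigidData (τ.mod M) hC hS h15 L).cor218_iv_fibre_of_prop214_i h214i) η hη).1 α hα

/-- The same, with Prop. 2.14 (i) DISCHARGED by abc-iut-L2-t8 for an [EtTh] ORIGIN (`IsEtThOrigin`,
`hYcl`: `rigidData_cor218_iv_fibre_of_origin`). [cite: MochizukiEtTh2009, Cor 2.18(iv) p.63] -/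
theorem finite_iso_over_levelOne_model_of_origin (hC : D.Compat) (hS : D.Sec2Hyps)
    (h15 : Prop15iii E hC) (L : C.CuspLabels) (hO : D.IsEtThOrigin)
    (hYcl : (D.DtpY.map D.toHat.toMonoidHom).topologicalClosure ≤
      D.DtpY.map D.toHat.toMonoidHom ⊔ (⁅⁅D.DeltaHat, D.DeltaHat⁆, D.DeltaHat⁆).topologicalClosure)
    (M : Es) {η : (C.thetaEnvTower τ hC hS).PiYdd → MuN p M}
    (hη : η ∈ (C.thetaEnvTower τ hC hS).thetaCocycles M) :
    Set.Finite {ψ : (((C.thetaEnvTower τ hC hS).level M).modelMono hη).Iso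
        (((C.thetaEnvTower τ hC hS).level M).modelMono hη) |
      ∀ x, (C.thetaEnvTower τ hC hS).redEnv (⟨1, τ.one_mem⟩ : Es) M
          (one_dvd _) (ψ.e x) =
        (C.thetaEnvTower τ hC hS).redEnv (⟨1, τ.one_mem⟩ : Es) M
          (one_dvd _) x} :=
  (C.thetaEnvTower τ hC hS).finite_iso_over_levelOne M hη fun α hα =>
    ((RigidData.cor218_iv_fibre_iff _).1
      (C.rigidData_cor218_iv_fibre_of_origin (τ.mod M) hC hS h15 L hO hYcl) η hη).1 α hα

end ThetaSetting.EtaleThetaData.DoubleUnderline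

end Literature.AnabelianGeometry.EtaleTheta
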